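import Mathlib
import HarnessLib
import Summits.AtomisticToContinuum.Crystallization.Theorems.PricedLinkCensusSoftFourRingsPathFamily
import Summits.AtomisticToContinuum.Crystallization.Theorems.PricedLinkCensusSoftFourRingsTightness
import Summits.AtomisticToContinuum.Crystallization.Theorems.PricedLinkCensusSoftFourRingsLocalHelpers
import Summits.AtomisticToContinuum.Crystallization.Theorems.PricedLinkCensusSoftFourRingsFanGap

/-!
# Soft four-rings: the apex vertices `p`, `q` of a slack-triangle block

Support file for `SoftFourRings` (route `PricedLinkCensus`, sub-problem `Crystallization`).

For a slack triangle `{a, b, c}` with `N(a) = {p, u, r, b}`, `N(c) = {p, m', m, q}`,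
`N(r) = {a, b, u, u'}` and the end triangle `g = {c, p, a}` (a facet), `apex_vertex` shows
**`N(p) = {a, u, c, m'}` and `t_p = 2`**: `u ≠ m'` since otherwise `u` would have five partners,
and `t_p = 3` would make `a`, `c` the two ends of the fan of `p` (their only partners in `N(p)`
are `u` resp. `m'`), contradicting the corner cap for the facet `g ∋ p, a, c`.
-/

namespace Summit.AtomisticToContinuum.Crystallization.Theorems

open Real RealInnerProductSpace Literature.Geometry.DiscreteGeometry

/-- Membership in the range of a `Fin 4` family as a four-fold disjunction. -/
theorem exists_fin_four_iff {α : Type*} (y : Fin 4 → α) (z : α) :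
    (∃ k, z = y k) ↔ (z = y 0 ∨ z = y 1 ∨ z = y 2 ∨ z = y 3) := by
  constructor
  · rintro ⟨k, rfl⟩
    fin_cases k <;> simp
  · rintro (rfl | rfl | rfl | rfl)
    exacts [⟨0, rfl⟩, ⟨1, rfl⟩, ⟨2, rfl⟩, ⟨3, rfl⟩]

/-- Four pairwise distinct points form an injective family. -/
theorem injective_vec4 {α : Type*} {a b c d : α} (hab : a ≠ b) (hac : a ≠ c) (had : a ≠ d)
    (hbc : b ≠ c) (hbd : b ≠ d) (hcd : c ≠ d) : Function.Injective ![a, b, c, d] := by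
  intro i j h
  fin_cases i <;> fin_cases j <;> simp_all

/-- Five pairwise distinct points form an injective family. -/
theorem injective_vec5 {α : Type*} {a b c d e : α} (hab : a ≠ b) (hac : a ≠ c) (had : a ≠ d)
    (hae : a ≠ e) (hbc : b ≠ c) (hbd : b ≠ d) (hbe : b ≠ e) (hcd : c ≠ d) (hce : c ≠ e)
    (hde : d ≠ e) : Function.Injective ![a, b, c, d, e] := by
  intro i j h
  fin_cases i <;> fin_cases j <;> simp_all

section Setting

variable {X : Finset (EuclideanSpace ℝ (Fin 3))} {B : Finset (Finset (EuclideanSpace ℝ (Fin 3)))}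
  (hT : musinTarasov2012_tammes_thirteen) (hX1 : ∀ y ∈ X, ‖y‖ = 1) (hcard : X.card = 12)
  (hsepX : ∀ u ∈ X, ∀ u' ∈ X, u ≠ u' → ⟪u, u'⟫ ≤ 1 - 1 / (2 * (101 / 100 : ℝ) ^ 2))
  (hB : ∀ T ∈ B, ∃ u ∈ X, ∃ u' ∈ X, u ≠ u' ∧ 1 - (101 / 100 : ℝ) ^ 2 / 2 ≤ ⟪u, u'⟫ ∧ T = {u, u'})
  (hBcard : B.card = 24)
  (hdeg : ∀ v ∈ X, ∃ w : Fin 4 → EuclideanSpace ℝ (Fin 3), (∀ k, w k ∈ X) ∧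
    Function.Injective w ∧ (∀ k, w k ≠ v) ∧
    (∀ k, ({v, w k} : Finset (EuclideanSpace ℝ (Fin 3))) ∈ B) ∧
    ∀ y, ({v, y} : Finset (EuclideanSpace ℝ (Fin 3))) ∈ B → ∃ k, y = w k)

include hB in
/-- **Ends of a path by unique partner.**  In a path family `z 0 – z 1 – z 2 – z 3`, a vertex
`z i` all of whose partners among the `z k` equal one point `t` is an end. -/
theorem end_of_unique_partner (z : Fin 4 → EuclideanSpace ℝ (Fin 3)) (hzinj : Function.Injective z)
    (hB01 : ({z 0, z 1} : Finset (EuclideanSpace ℝ (Fin 3))) ∈ B)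
    (hB12 : ({z 1, z 2} : Finset (EuclideanSpace ℝ (Fin 3))) ∈ B)
    (hB23 : ({z 2, z 3} : Finset (EuclideanSpace ℝ (Fin 3))) ∈ B) (i : Fin 4)
    {t : EuclideanSpace ℝ (Fin 3)}
    (huniq : ∀ k, ({z i, z k} : Finset (EuclideanSpace ℝ (Fin 3))) ∈ B → z k = t) :
    i = 0 ∨ i = 3 := by
  have _ := hB
  fin_cases i
  · exact Or.inl rfl
  · exfalso
    have h0 : z 0 = t := huniq 0 (by rw [Finset.pair_comm]; exact hB01)
    have h2 : z 2 = t := huniq 2 hB12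
    exact absurd (hzinj (h0.trans h2.symm)) (by decide)
  · exfalso
    have h1 : z 1 = t := huniq 1 (by rw [Finset.pair_comm]; exact hB12)
    have h3 : z 3 = t := huniq 3 hB23
    exact absurd (hzinj (h1.trans h3.symm)) (by decide)
  · exact Or.inr rfl

include hT hX1 hcard hsepX hB hBcard hdeg in
open scoped Classical in
/-- **The apex vertex of an end triangle**: `N(p) = {a, u, c, m'}` and `t_p = 2`.  (Stated
for `p`; the statement for `q` is the same one with `a ↔ b`, `u ↔ u'`, `m ↔ m'`, `p ↔ q`.) -/
theorem apex_vertex {a b c p q u u' m m' r : EuclideanSpace ℝ (Fin 3)}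
    (hc : c ∈ X) (hp : p ∈ X) (hu : u ∈ X)
    (hNa : ∀ y, ({a, y} : Finset (EuclideanSpace ℝ (Fin 3))) ∈ B ↔ (y = p ∨ y = u ∨ y = r ∨ y = b))
    (hNc : ∀ y, ({c, y} : Finset (EuclideanSpace ℝ (Fin 3))) ∈ B ↔ (y = p ∨ y = m' ∨ y = m ∨ y = q))
    (hNr : ∀ y, ({r, y} : Finset (EuclideanSpace ℝ (Fin 3))) ∈ B ↔ (y = a ∨ y = b ∨ y = u ∨ y = u'))
    (hpu : ({p, u} : Finset (EuclideanSpace ℝ (Fin 3))) ∈ B)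
    (hpm' : ({p, m'} : Finset (EuclideanSpace ℝ (Fin 3))) ∈ B)
    (hm'm : ({m', m} : Finset (EuclideanSpace ℝ (Fin 3))) ∈ B)
    (hbu' : ({b, u'} : Finset (EuclideanSpace ℝ (Fin 3))) ∈ B)
    (hca : ({c, a} : Finset (EuclideanSpace ℝ (Fin 3))) ∉ B)
    (hcb : ({c, b} : Finset (EuclideanSpace ℝ (Fin 3))) ∉ B)
    (hqa : ({q, a} : Finset (EuclideanSpace ℝ (Fin 3))) ∉ B)
    (hac : a ≠ c) (hpr : p ≠ r) (hur : u ≠ r) (hub : u ≠ b) (hpm : p ≠ m) (hm'q : m' ≠ q)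
    (hmc : m ≠ c) {g : EuclideanSpace ℝ (Fin 3)} (hgF : g ∈ facetNormals X)
    (hgT : tightSet X g = {c, p, a}) :
    (∀ y, ({p, y} : Finset (EuclideanSpace ℝ (Fin 3))) ∈ B ↔ (y = a ∨ y = u ∨ y = c ∨ y = m')) ∧
    ((facetNormals X).filter (fun c' => p ∈ tightSet X c' ∧ (tightSet X c').card = 3 ∧
      ((edgesOfFacet X c').filter (fun T => T ∉ B)).card = 0)).card = 2 ∧ u ≠ m' := by
  have h0 : (0 : EuclideanSpace ℝ (Fin 3)) ∈ interior (convexHull ℝ (X : Set (EuclideanSpace ℝ (Fin 3)))) :=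
    zero_mem_interior_convexHull_of_twelve_le_card hT hX1 hcard.ge
      (ca := 1 - 1 / (2 * (101 / 100 : ℝ) ^ 2)) (by norm_num) hsepX
  obtain ⟨-, hC1, -, -, -⟩ := tight_counts_one_percent hT hX1 hcard hsepX hB hBcard hdeg
  -- bonds read off the neighbourhoods
  have hap : ({a, p} : Finset (EuclideanSpace ℝ (Fin 3))) ∈ B := (hNa p).2 (Or.inl rfl)
  have hau : ({a, u} : Finset (EuclideanSpace ℝ (Fin 3))) ∈ B := (hNa u).2 (Or.inr (Or.inl rfl))
  have har : ({a, r} : Finset (EuclideanSpace ℝ (Fin 3))) ∈ B :=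
    (hNa r).2 (Or.inr (Or.inr (Or.inl rfl)))
  have hab : ({a, b} : Finset (EuclideanSpace ℝ (Fin 3))) ∈ B :=
    (hNa b).2 (Or.inr (Or.inr (Or.inr rfl)))
  have hcp : ({c, p} : Finset (EuclideanSpace ℝ (Fin 3))) ∈ B := (hNc p).2 (Or.inl rfl)
  have hcm' : ({c, m'} : Finset (EuclideanSpace ℝ (Fin 3))) ∈ B := (hNc m').2 (Or.inr (Or.inl rfl))
  have hcm : ({c, m} : Finset (EuclideanSpace ℝ (Fin 3))) ∈ B :=
    (hNc m).2 (Or.inr (Or.inr (Or.inl rfl)))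
  have hcq : ({c, q} : Finset (EuclideanSpace ℝ (Fin 3))) ∈ B :=
    (hNc q).2 (Or.inr (Or.inr (Or.inr rfl)))
  have hru : ({r, u} : Finset (EuclideanSpace ℝ (Fin 3))) ∈ B :=
    (hNr u).2 (Or.inr (Or.inr (Or.inl rfl)))
  -- elementary distinctness
  have hpa : p ≠ a := (ne_of_mem_bonds hB hap).symm
  have hua : u ≠ a := (ne_of_mem_bonds hB hau).symm
  have hra : r ≠ a := (ne_of_mem_bonds hB har).symm
  have hba : b ≠ a := (ne_of_mem_bonds hB hab).symm
  have hpc : p ≠ c := (ne_of_mem_bonds hB hcp).symm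
  have hm'c : m' ≠ c := (ne_of_mem_bonds hB hcm').symm
  have hqc : q ≠ c := (ne_of_mem_bonds hB hcq).symm
  have hpu' : p ≠ u := ne_of_mem_bonds hB hpu
  have hm'm' : m' ≠ m := ne_of_mem_bonds hB hm'm
  have hpm'' : p ≠ m' := ne_of_mem_bonds hB hpm'
  have hca' : ∀ y, ({c, y} : Finset (EuclideanSpace ℝ (Fin 3))) ∈ B → y ≠ a := by
    rintro y hy rfl; exact hca hy
  have hca'' : ∀ y, ({a, y} : Finset (EuclideanSpace ℝ (Fin 3))) ∈ B → y ≠ c := by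
    rintro y hy rfl; exact hca (by rw [Finset.pair_comm]; exact hy)
  have hcb' : ∀ y, ({c, y} : Finset (EuclideanSpace ℝ (Fin 3))) ∈ B → y ≠ b := by
    rintro y hy rfl; exact hcb hy
  have hma : m ≠ a := hca' m hcm
  have hm'a : m' ≠ a := hca' m' hcm'
  have hqa' : q ≠ a := hca' q hcq
  have hm'b : m' ≠ b := hcb' m' hcm'
  have huc : u ≠ c := hca'' u hau
  have hrc : r ≠ c := hca'' r har
  have hbc : b ≠ c := hca'' b hab
  have hqu : q ≠ u := fun h => hqa (by rw [h, Finset.pair_comm]; exact hau)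
  -- `c ∉ N(r)`, hence `r ≠ m`, `r ≠ m'`
  have hrc' : ({r, c} : Finset (EuclideanSpace ℝ (Fin 3))) ∉ B := by
    intro h
    rcases (hNr c).1 h with h' | h' | h' | h'
    · exact hac h'.symm
    · exact hbc h'.symm
    · exact huc h'.symm
    · exact hcb (by rw [h', Finset.pair_comm]; exact hbu')
  have hrm : r ≠ m := fun h => hrc' (by rw [h, Finset.pair_comm]; exact hcm)
  have hrm' : r ≠ m' := fun h => hrc' (by rw [h, Finset.pair_comm]; exact hcm')
  -- (D) `u ≠ m'` and `u ≠ m`: otherwise `u` has the five partners `a, p, r, c, m` resp. `m'`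
  have hfive : ∀ n : EuclideanSpace ℝ (Fin 3), n ≠ a → p ≠ n → r ≠ n → n ≠ c →
      ({c, u} : Finset (EuclideanSpace ℝ (Fin 3))) ∈ B →
      ({u, n} : Finset (EuclideanSpace ℝ (Fin 3))) ∈ B → False := by
    intro n hna hpn hrn hnc hcu hun
    refine five_partners_false hdeg hu ![a, p, r, c, n]
      (injective_vec5 hpa.symm hra.symm hac (Ne.symm hna) hpr hpc hpn hrc hrn (Ne.symm hnc)) ?_
    intro k
    fin_cases k
    · simpa [Finset.pair_comm] using hau
    · simpa [Finset.pair_comm] using hpu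
    · simpa [Finset.pair_comm] using hru
    · simpa [Finset.pair_comm] using hcu
    · simpa using hun
  have hum' : u ≠ m' := by
    intro h
    exact hfive m hma hpm hrm hmc (by rw [h]; exact hcm') (by rw [h]; exact hm'm)
  have hum : u ≠ m := by
    intro h
    exact hfive m' hm'a hpm'' hrm' hm'c (by rw [h]; exact hcm)
      (by rw [h, Finset.pair_comm]; exact hm'm)
  -- (E) `N(p) = {a, u, c, m'}`
  have hNp : ∀ y, ({p, y} : Finset (EuclideanSpace ℝ (Fin 3))) ∈ B ↔
      (y = a ∨ y = u ∨ y = c ∨ y = m') := by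
    intro y
    refine (partners_iff_of_four hdeg hp ![a, u, c, m']
      (injective_vec4 hua.symm hac hm'a.symm huc hum' hm'c.symm) ?_ y).trans ?_
    swap
    · rw [exists_fin_four_iff]
      simp only [Fin.isValue, Matrix.cons_val_zero, Matrix.cons_val_one, Matrix.cons_val]
    intro k
    fin_cases k
    · simpa [Finset.pair_comm] using hap
    · simpa using hpu
    · simpa [Finset.pair_comm] using hcp
    · simpa using hpm'
  refine ⟨hNp, ?_, hum'⟩
  -- (F) `t_p = 2`
  rcases hC1 p hp with h2 | h3
  · exact h2
  exfalso
  obtain ⟨z₀, hzX₀, hzinj₀, hzp₀, hpz₀, honly₀⟩ := hdeg p hp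
  obtain ⟨z, hzX, hzinj, hzp, hpz, honly, hB01, hB12, hB23, -, -, -⟩ :=
    exists_path_family_of_three hX1 h0 hsepX hB hp z₀ hzX₀ hzinj₀ hzp₀ hpz₀ honly₀ h3
  have hzN : ∀ k, z k = a ∨ z k = u ∨ z k = c ∨ z k = m' := fun k => (hNp (z k)).1 (hpz k)
  -- the only partner of `a` in `N(p)` is `u`; the only partner of `c` in `N(p)` is `m'`
  have ha_uniq : ∀ k, ({a, z k} : Finset (EuclideanSpace ℝ (Fin 3))) ∈ B → z k = u := by
    intro k hk
    rcases (hNa (z k)).1 hk with e | e | e | e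
    · exact absurd e (hzp k)
    · exact e
    · rcases hzN k with e' | e' | e' | e'
      · exact absurd (e.symm.trans e') hra
      · exact absurd (e.symm.trans e') hur.symm
      · exact absurd (e.symm.trans e') hrc
      · exact absurd (e.symm.trans e') hrm'
    · rcases hzN k with e' | e' | e' | e'
      · exact absurd (e.symm.trans e') hba
      · exact absurd (e.symm.trans e') hub.symm
      · exact absurd (e.symm.trans e') hbc
      · exact absurd (e.symm.trans e') hm'b.symm
  have hc_uniq : ∀ k, ({c, z k} : Finset (EuclideanSpace ℝ (Fin 3))) ∈ B → z k = m' := by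
    intro k hk
    rcases (hNc (z k)).1 hk with e | e | e | e
    · exact absurd e (hzp k)
    · exact e
    · rcases hzN k with e' | e' | e' | e'
      · exact absurd (e.symm.trans e') hma
      · exact absurd (e.symm.trans e') hum.symm
      · exact absurd (e.symm.trans e') hmc
      · exact absurd (e.symm.trans e') hm'm'.symm
    · rcases hzN k with e' | e' | e' | e'
      · exact absurd (e.symm.trans e') hqa'
      · exact absurd (e.symm.trans e') hqu
      · exact absurd (e.symm.trans e') hqc
      · exact absurd (e.symm.trans e') hm'q.symm
  obtain ⟨ka, hka⟩ := honly a (by rw [Finset.pair_comm]; exact hap)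
  obtain ⟨kc, hkc⟩ := honly c (by rw [Finset.pair_comm]; exact hcp)
  have hka03 := end_of_unique_partner hB z hzinj hB01 hB12 hB23 ka (t := u)
    (fun k hk => ha_uniq k (by rw [hka]; exact hk))
  have hkc03 := end_of_unique_partner hB z hzinj hB01 hB12 hB23 kc (t := m')
    (fun k hk => hc_uniq k (by rw [hkc]; exact hk))
  -- so `{z 0, z 3} = {a, c}` and the facet `g` contains `p` and both ends: corner cap
  have hgN := mem_facetNormals.1 hgF
  have hpg : p ∈ tightSet X g := by rw [hgT]; simp
  have hag : a ∈ tightSet X g := by rw [hgT]; simp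
  have hcg : c ∈ tightSet X g := by rw [hgT]; simp
  have hends : z 0 ∈ tightSet X g ∧ z 3 ∈ tightSet X g := by
    rcases hka03 with rfl | rfl <;> rcases hkc03 with rfl | rfl
    · exact absurd (hka.trans hkc.symm) hac
    · exact ⟨hka ▸ hag, hkc ▸ hcg⟩
    · exact ⟨hkc ▸ hcg, hka ▸ hag⟩
    · exact absurd (hka.trans hkc.symm) hac
  have hvwc : ∀ k, 1 - (101 / 100 : ℝ) ^ 2 / 2 ≤ ⟪p, z k⟫ :=
    fun k => (close_of_pair_mem_bonds hB (hpz k) (hzp k).symm).2.2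
  exact no_facet_through_three_fan_one_percent hT hX1 hcard.ge hsepX hp z hzX hzinj hzp hvwc
    (close_of_mem_bonds hX1 hB _ _ hB01) (close_of_mem_bonds hX1 hB _ _ hB12)
    (close_of_mem_bonds hX1 hB _ _ hB23) hgN.1 (mem_tightSet.1 hpg).2
    (mem_tightSet.1 hends.1).2 (mem_tightSet.1 hends.2).2

end Setting

end Summit.AtomisticToContinuum.Crystallization.Theorems
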